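import Literature.NumberTheory.LFunctions.WeilFirstPrimePositivityC
import Literature.NumberTheory.LFunctions.UniformWeilPositivityRH
import Literature.NumberTheory.ConnesConsani2021.ArchimedeanSoninTrace
import HarnessLib

/-!
# Connes's property `P(n)`: Weil positivity involving only the Euler factors of the primes `< n` (AS PRINTED)

Topic `Literature/NumberTheory/ConnesConsani2021` (the Connes–Consani semi-local programme).  Typed, AS
PRINTED and in the vocabulary of `Literature/NumberTheory/LFunctions/WeilExplicit.lean` (additive variable
`t = log x`, `weilQuadratic g = W(g ⋆ g̃)`) and of `ArchimedeanSoninTrace.lean` (CC's multiplicative Fourier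
transform `mulFourier g s = ĝ(s) = ∫₀^∞ g(x) x^{-is} d*x`), from

> A. Connes, *The Riemann Hypothesis: Past, Present and a Letter Through Time* (2026), arXiv:2602.04022,
> §4.1 "Weil's Positivity Criterion" [bib: `Connes2026Letter`; corpus `paper:arxiv-2602.04022`, chunk p0017].

## What is printed (chunk p0017 of the corpus text; line numbers of that chunk)

* L15–18: "there exists a property `P(n)`, involving only the Euler factors for primes smaller than `n`, and
  whose validity for all `n` is equivalent to RH.  This is derived from Weil's positivity criterion which
  involves the quadratic form `QW` defined using the Riemann-Weil explicit formulas applied to test functions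
  with support in a compact symmetric interval."
* L22–33: the explicit formula `f̂(i/2) − Σ_{1/2+is ∈ Z} f̂(s) + f̂(−i/2) = Σ_v W_v(f)`,
  `f̂(s) := ∫₀^∞ f(x) x^{−is} d*x`, with `W_p(f) := (log p) Σ_{m≥1} p^{−m/2}(f(p^m) + f(p^{−m}))` and
  `W_ℝ(f) := (log 4π + γ) f(1) + ∫₁^∞ (f(x) + f(x⁻¹) − 2x^{−1/2} f(1)) x^{1/2}/(x − x⁻¹) d*x`.
* L35–37: "The key result of André Weil is the equivalence
  `RH ⟺ Σ_v W_v(g ∗ g*) ≤ 0, ∀ g, ĝ(±i/2) = 0`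
  where `g ∈ C_c^∞(ℝ₊*)` is smooth with compact support and `g*(x) := ḡ(x⁻¹)`."
* L40: "the sum on the right-hand side, when evaluated on a test function `g` with compact support, involves
  only finitely many primes (since `W_p` vanishes on functions with support in `(p⁻¹, p)`)."
* L42–44 (the printed frontier): "In [yoshida] H. Yoshida proved … For any smooth, positive definite function `f`
  with support in the interval `(1/2, 2)` and whose Fourier transform vanishes at `±i/2` one has:
  `W_∞(f) ≥ 0` where `W_∞ := −W_ℝ`" — this is `P(2)`; Connes–Consani 2021 Thm 1 strengthens it on a subspace.

`P(n)` is DESCRIBED, not displayed.  READING typed here (the only one matching L15–18 + L35–40): `P(n)` :=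
Weil's inequality for the test functions `g` with `Supp g ⊂ [n^{−1/2}, n^{1/2}]` (so `Supp(g ∗ g*) ⊂ [n⁻¹, n]`
and exactly the primes `p < n` enter `Σ_v W_v`, the end points carrying no mass for smooth `g`) and
`ĝ(±i/2) = 0`.  DICTIONARY (module docstring of `ArchimedeanSoninTrace.lean`; `mulFourier_I_half`,
`mulFourier_neg_I_half`): `ĝ(i/2) = weilMellin g 1`, `ĝ(−i/2) = weilMellin g 0`; by the explicit formula
as displayed, `Σ_{zeros} f̂ = (polar terms) − Σ_v W_v(f) = weilFunctional f`, so on this POLE-FREE class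
(`weilPolarTerm (g ⋆ g̃) = 2 Re(ĝ(0) conj ĝ(1)) = 0`) the printed `Σ_v W_v(g ∗ g*) ≤ 0` is the tree's
`0 ≤ Re (weilQuadratic g)`.  The variant WITHOUT the two vanishing conditions is the tree's
`WeilPositivityOn (log n / 2)` (= positivity of CC's semi-local form `QW_λ`, `λ² = n`, Connes–Consani 2023
Prop. 2.1), which implies `P(n)` (`weilPropertyP_of_weilPositivityOn`).

## Status (numbers, not adjectives)

In print: `P(2)` is a THEOREM (Yoshida 1992 Thm 1; Connes–Consani 2021 Thm 1), `P(n)`, `n ≥ 3`, OPEN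
(Connes 2026 L42–46 names `P(2)` as what is proved).  In the tree: `P(2)` (`weilPropertyP_two`, from
`weilPositivityOn_log_two_half_holds`) and **`P(3)` — the first case with a prime, CC's "S = {∞, 2}" —
PROVED** (`weilPropertyP_three`, from the kernel-checked Stage-C certificate behind
`weilPositivityOn_log_three_half`, window `a = (log 3)/2 ≤ 563/1024`); `P(4)` follows from the tree's
`weilPositivityOn_log_two` (a Summits theorem; recorded there, `Theorems/ConnesPropertyPCriterion.lean`), and
`P(5) = WeilPositivityOn ((log 5)/2)` is `1.2·10⁻⁴` beyond the proved frontier `a = 4023/5000`.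
`RH → ∀ n, P(n)` is here (`weilPropertyP_of_riemannHypothesis`); the printed equivalence
`(∀ n, P(n)) ↔ RH` is reduced here to the window-free pole-free criterion
(`forall_weilPropertyP_iff_poleFree`) and PROVED in
`Summits/RiemannHypothesis/RiemannHypothesis/Theorems/ConnesPropertyPCriterion.lean`
(`riemannHypothesis_iff_forall_weilPropertyP`) from the tree's pole-free form of Weil's criterion
(Bombieri 2000 Thms 1–2) — no named fact is left as debt.  No RH claim.
-/

noncomputable section

open Set Complex

namespace Literature.NumberTheory.ConnesConsani2021

open Literature.NumberTheory.LFunctions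

/-- **Connes's property `P(n)`** (Connes 2026 §4.1): Weil's inequality `Σ_v W_v(g ∗ g*) ≤ 0` for every
smooth `g` compactly supported in `[n^{−1/2}, n^{1/2}] ⊂ ℝ₊*` with `ĝ(i/2) = ĝ(−i/2) = 0` — "involving only the
Euler factors for primes smaller than `n`".  Additive avatar: `tsupport g ⊆ [−(log n)/2, (log n)/2]`,
`mulFourier g (±i/2) = 0`, conclusion `0 ≤ Re W(g ⋆ g̃)` (the polar term vanishes on this class, so this IS
the printed `−Σ_v W_v(g ∗ g*) ≥ 0`).  `P(n)` is described in words in the source; this is the reading fixed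
in the module docstring. [cite: Connes2026Letter, §4.1 p. 17 (arXiv chunk p0017 L15–18, L35–40)] -/
def weilPropertyP (n : ℕ) : Prop :=
  ∀ g : ℝ → ℂ, IsWeilTest g → tsupport g ⊆ Icc (-(Real.log n / 2)) (Real.log n / 2) →
    mulFourier g (I / 2) = 0 → mulFourier g (-(I / 2)) = 0 → 0 ≤ (weilQuadratic g).re

/-- `P(n)` in the tree's Mellin normalisation: the two printed conditions `ĝ(±i/2) = 0` are
`weilMellin g 1 = 0` and `weilMellin g 0 = 0` (pole-free test functions). [cite: ConnesConsani2021, App. A p. 30 (f̂(s) dictionary); Connes2026Letter §4.1 p. 17] -/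
theorem weilPropertyP_iff (n : ℕ) :
    weilPropertyP n ↔
      ∀ g : ℝ → ℂ, IsWeilTest g → tsupport g ⊆ Icc (-(Real.log n / 2)) (Real.log n / 2) →
        weilMellin g 0 = 0 → weilMellin g 1 = 0 → 0 ≤ (weilQuadratic g).re := by
  refine forall_congr' fun g ↦ forall_congr' fun hg ↦ forall_congr' fun _ ↦ ?_
  rw [mulFourier_I_half, mulFourier_neg_I_half]
  exact ⟨fun h h0 h1 ↦ h h1 h0, fun h h1 h0 ↦ h h0 h1⟩

/-- Positivity of the semi-local form on the whole window (`WeilPositivityOn ((log n)/2)`, no vanishing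
condition; Connes–Consani 2023 Prop. 2.1's `QW_λ ≥ 0`, `λ² = n`) implies `P(n)`. [cite: Connes2026Letter, §4.1 p. 17 L35–40 (P(n) is Weil's inequality restricted by support and by ĝ(±i/2) = 0)] -/
theorem weilPropertyP_of_weilPositivityOn {n : ℕ} (h : WeilPositivityOn (Real.log n / 2)) :
    weilPropertyP n :=
  fun g hg hsupp _ _ ↦ h g hg hsupp

/-- `log` is monotone on `ℕ` (with `log 0 = 0 ≤ log n`). [folklore] -/
private theorem log_natCast_mono {m n : ℕ} (h : m ≤ n) : Real.log m ≤ Real.log n := by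
  rcases Nat.eq_zero_or_pos m with rfl | hm
  · simpa using Real.log_natCast_nonneg n
  · exact Real.log_le_log (by exact_mod_cast hm) (by exact_mod_cast h)

/-- `P(n)` is antitone in `n`: a smaller window is contained in a larger one ("`W_p` vanishes on functions
with support in `(p⁻¹, p)`": fewer primes enter). [cite: Connes2026Letter, §4.1 p. 17 L40] -/
theorem weilPropertyP.mono {m n : ℕ} (h : weilPropertyP n) (hmn : m ≤ n) : weilPropertyP m := by
  intro g hg hsupp h1 h0
  have hl : Real.log m / 2 ≤ Real.log n / 2 := by linarith [log_natCast_mono hmn]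
  exact h g hg (hsupp.trans (Icc_subset_Icc (neg_le_neg hl) hl)) h1 h0

/-- **`P(2)` — the printed frontier** (no prime enters: Yoshida 1992 Thm 1, Connes–Consani 2021 Thm 1;
in the tree `weilPositivityOn_log_two_half_holds`, a kernel certificate). [cite: Yoshida1992HermitianForms, Thm. 1 (p. 310); Connes2026Letter §4.1 p. 17 L42–44] -/
theorem weilPropertyP_two : weilPropertyP 2 :=
  weilPropertyP_of_weilPositivityOn (by exact_mod_cast weilPositivityOn_log_two_half_holds)

/-- `P(n)` for `n ≤ 2` (windows inside the archimedean one). [cite: Yoshida1992HermitianForms, Thm. 1 (p. 310)] -/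
theorem weilPropertyP_of_le_two {n : ℕ} (hn : n ≤ 2) : weilPropertyP n :=
  weilPropertyP_two.mono hn

/-- **`P(3)` — the first case with a prime (only `p = 2 < 3` enters; Connes–Consani's "S = {∞, 2}"), OPEN in
print, PROVED in the tree**: it is implied by `WeilPositivityOn ((log 3)/2)`
(`weilPositivityOn_log_three_half`), itself the kernel-checked Stage-C first-prime certificate `weilCert3C`
(`a₀ = b = 563/1024 ≥ (log 3)/2`) through the soundness theorem
`WeilCert3.weilFirstPrimeQuadratic_nonneg_of_check`. [cite: Connes2026Letter, §4.1 p. 17 L15–18 (the property); certificate in tree] -/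
theorem weilPropertyP_three : weilPropertyP 3 :=
  weilPropertyP_of_weilPositivityOn (by exact_mod_cast weilPositivityOn_log_three_half)

/-- `RH → P(n)` for every `n` (the easy half of Weil's criterion, `weil_criterion_holds.1`). [cite: Bombieri2000Weil, Thm. 1 eq. (3.2) (easy half)] -/
theorem weilPropertyP_of_riemannHypothesis (hRH : RiemannHypothesis) (n : ℕ) : weilPropertyP n :=
  fun g hg _ _ _ ↦ weil_criterion_holds.1 hRH g hg

/-- Every test function is supported in the window of some `P(n)`. [folklore] -/
private theorem exists_tsupport_subset_window {g : ℝ → ℂ} (hg : IsWeilTest g) :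
    ∃ n : ℕ, tsupport g ⊆ Icc (-(Real.log n / 2)) (Real.log n / 2) := by
  obtain ⟨R, hR⟩ := hg.2.isCompact.isBounded.subset_closedBall 0
  rw [Real.closedBall_eq_Icc, zero_sub, zero_add] at hR
  refine ⟨⌈Real.exp (2 * max R 0)⌉₊, hR.trans ?_⟩
  have h1 : Real.exp (2 * max R 0) ≤ (⌈Real.exp (2 * max R 0)⌉₊ : ℝ) := Nat.le_ceil _
  have h2 : 2 * max R 0 ≤ Real.log (⌈Real.exp (2 * max R 0)⌉₊ : ℕ) := by
    have := Real.log_le_log (Real.exp_pos _) h1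
    rwa [Real.log_exp] at this
  have h3 : R ≤ Real.log (⌈Real.exp (2 * max R 0)⌉₊ : ℕ) / 2 := by
    linarith [le_max_left R 0]
  exact Icc_subset_Icc (neg_le_neg h3) h3

/-- **"validity for all `n`" is the window-free pole-free inequality**: `(∀ n, P(n))` iff
`0 ≤ Re W(g ⋆ g̃)` for EVERY smooth compactly supported `g` with `ĝ(0) = ĝ(1) = 0` (every test lives in
some window). [cite: Connes2026Letter, §4.1 p. 17 L35–40] -/
theorem forall_weilPropertyP_iff_poleFree :
    (∀ n, weilPropertyP n) ↔
      ∀ g : ℝ → ℂ, IsWeilTest g → weilMellin g 0 = 0 → weilMellin g 1 = 0 →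
        0 ≤ (weilQuadratic g).re := by
  constructor
  · intro h g hg h0 h1
    obtain ⟨n, hn⟩ := exists_tsupport_subset_window hg
    exact (weilPropertyP_iff n).1 (h n) g hg hn h0 h1
  · intro h n
    exact (weilPropertyP_iff n).2 fun g hg _ h0 h1 ↦ h g hg h0 h1

end Literature.NumberTheory.ConnesConsani2021

end
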